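import Mathlib
import HarnessLib
import Summits.NavierStokesRegularity.NavierStokesRegularity.Theorems.TypeILiouvilleShorelinePlanarWallAnyDirection
import Summits.NavierStokesRegularity.NavierStokesRegularity.Theorems.TypeILiouvilleShorelineSectors
import Summits.NavierStokesRegularity.NavierStokesRegularity.Theorems.TypeILiouvilleLatticeLiouville
import Summits.NavierStokesRegularity.NavierStokesRegularity.Theorems.PoloidalWindowDoorPoloidalWindowRigidityVorticityTranslate
import Literature.Analysis.FluidPDE.LocalBiotSavartCalculus

/-!
# TypeILiouvilleVorticitySymmetry — crux (L) stmt-NavierStokesRegularity-10661 `TypeIliouvilleL`: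
# SYMMETRIES / HARMONICITY OF THE VORTICITY OF ONE SLICE NEAR ONE PATCH DECIDE THE WHOLE FLOW

Helper for stmt-NavierStokesRegularity-10661 (`--supports`); theorems only, no definitions, no named-fact hypotheses;
closes no item; Navier–Stokes regularity is NOT proved here (leafhand seat of the EulerZoomLiouville route; companion of
`TypeILiouvilleGeneralizedBeltrami`, same endgame idea).

Class P = print's class of bounded ancient mild solutions (KNSS 2009 §4 (i)).  KNSS's Liouville lemma for the system
`curl z = 0, div z = 0` applied to FINITE DIFFERENCES `z = V(· + h) − V` says that every translation preserving the curl
of a bounded divergence-free `C²` field preserves the field (tree: route PoloidalWindowDoor,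
`PoloidalWindowDoorPoloidalWindowRigidityVorticityTranslate.periodic_of_curl_periodic`, there used in the Type-I class).
On class P, where the vorticity of a slice is real-analytic and one locally symmetric slice forces a globally symmetric
flow (the Shoreline files), this upgrades VELOCITY-symmetry sectors of (L) already in the tree to VORTICITY hypotheses
read off ONE PATCH OF ONE SLICE:

* §2 `classP_translationInvariant_of_curl_locally` — `curl v(t₀)(x + h) = curl v(t₀)(x)` for `x` in one nonempty open
  set ⟹ `v(t)(x + h) = v(t)(x)` for all `t < 0`, all `x`.
* §3 ★ `classP_const_of_curl_locallyLineInvariant` — the vorticity of ONE slice invariant under small translations along a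
  line on ONE patch ⟹ ONE CONSTANT VECTOR (the 2½-D wall `classP_const_of_locallyTranslationInvariant`, KNSS Thm 5.1,
  now from the vorticity alone); ★ `classP_const_of_curl_latticePeriodic_slice` — the vorticity of ONE slice `ℤ³`-periodic
  (globally, or on one patch: `classP_const_of_curl_locallyLatticePeriodic_slice`) ⟹ ONE CONSTANT VECTOR (the periodic
  sieve `classP_const_of_isLatticePeriodic`, now from the vorticity of one slice).
* §4 ★ `classP_const_of_curl_locallyHarmonic_slice` — the vorticity of ONE slice HARMONIC on ONE patch (`Δω(t₀) = 0`
  there) ⟹ ONE CONSTANT VECTOR (`Δω` is analytic; bounded harmonic `ω(t₀)` is constant; constant curl ⟹ constant slice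
  ⟹ constant flow); the Type-I twin is `…VorticityTranslate.eq_zero_of_curl_harmonic_slice`.
READING on the residual of (L): a counterexample's vorticity has, on every patch of every slice, NO translational
period, NO invariant direction, and is NOT harmonic.  HONEST LABEL: classical sectors; nothing here proves a
registered stub, (L), or Navier–Stokes regularity; rung 0.
[cite: KochNadirashviliSereginSverak2009, Lemma 3.1 p. 7, Thm. 5.1 p. 9, Remark 6.1 (arXiv:0709.3599)] [cite: LemarieRieusset2016, Thm. 9.12]
-/

noncomputable section
open MeasureTheory Filter Set Function Metric
open scoped Topology ENNReal RealInnerProductSpace ContDiff Laplacian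
open Literature.Analysis Literature.Analysis.FunctionSpaces Literature.Analysis.FluidPDE Literature.Analysis.UnboundedOperators
open Summit.NavierStokesRegularity.NavierStokesRegularity.Theorems.TypeILiouvilleShoreline
open Summit.NavierStokesRegularity.NavierStokesRegularity.Theorems.TypeILiouvilleLatticeMomentum
set_option linter.dupNamespace false
namespace Summit.NavierStokesRegularity.NavierStokesRegularity.Theorems.TypeILiouvilleVorticitySymmetry

/-! ## §2 On class P: one patch of one slice -/

/-- **A LOCAL TRANSLATIONAL SYMMETRY OF THE VORTICITY OF ONE SLICE IS A SYMMETRY OF THE FLOW.**  If for one `t₀ < 0`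
and one vector `h`, `curl v(t₀)(x + h) = curl v(t₀)(x)` for all `x` in ONE nonempty open set, then `v(t)(x + h) =
v(t)(x)` for ALL `t < 0` and ALL `x`: the analytic function `x ↦ curl v(t₀)(x + h) − curl v(t₀)(x)`
(`classP_curl_analyticOnNhd_slice`) vanishes identically; §1 makes `h` a period of the bounded divergence-free slice
`v t₀`; one periodic slice makes every slice periodic (`classP_spacePeriodic_of_locallyPeriodic`).
[cite: LemarieRieusset2016, Thm. 9.12; KochNadirashviliSereginSverak2009, Lemma 3.1, Remark 6.1 (arXiv:0709.3599)] -/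
theorem classP_translationInvariant_of_curl_locally
    {v : ℝ → EuclideanSpace ℝ (Fin 3) → EuclideanSpace ℝ (Fin 3)}
    (hc : ContinuousOn (uncurry v) (Iio 0 ×ˢ univ))
    (hK : ∃ K : ℝ, ∀ t < 0, ∀ x, ‖v t x‖ ≤ K)
    (hd : ∀ t < 0, IsWeaklyDivFree (v t))
    (hm : ∀ s t : ℝ, s < t → t < 0 → ∀ x,
      v t x = heatExtension (v s) (t - s) x - oseenDuhamel 1 s v v t x)
    (h : EuclideanSpace ℝ (Fin 3)) {t₀ : ℝ} (ht₀ : t₀ < 0)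
    {U : Set (EuclideanSpace ℝ (Fin 3))} (hUo : IsOpen U) (hUne : U.Nonempty)
    (hloc : ∀ x ∈ U, curl (v t₀) (x + h) = curl (v t₀) x) :
    ∀ t < 0, ∀ x, v t (x + h) = v t x := by
  obtain ⟨K, hKb⟩ := hK
  -- the curl of the slice is analytic, so the symmetry is global on the slice
  have hcurl_an : AnalyticOnNhd ℝ (curl (v t₀)) univ := classP_curl_analyticOnNhd_slice hc ⟨K, hKb⟩ hm ht₀
  have hdiff_an : AnalyticOnNhd ℝ (fun x => curl (v t₀) (x + h) - curl (v t₀) x) univ := by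
    intro x _
    have hτ : AnalyticAt ℝ (fun y : EuclideanSpace ℝ (Fin 3) => y + h) x := analyticAt_id.add analyticAt_const
    have h1 : AnalyticAt ℝ (fun y => curl (v t₀) (y + h)) x :=
      (hcurl_an (x + h) (mem_univ _)).comp_of_eq hτ rfl
    exact h1.sub (hcurl_an x (mem_univ _))
  have hglob : ∀ x, curl (v t₀) (x + h) = curl (v t₀) x := by
    intro x
    have h0 := const_of_analyticOnNhd_of_locallyConst hdiff_an hUo hUne (b := 0)
      (fun y hy => by simp only [hloc y hy, sub_self]) x
    exact sub_eq_zero.1 h0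
  -- the finite-difference Liouville lemma on the slice `t₀`
  obtain ⟨hsm', -⟩ := smooth_and_bounds_of_bounded_ancient_oseenMild hc hd hm hKb
  have hsm : IsSmoothSpaceTimeOn (Iio 0) v := hsm'
  have h2 : ContDiff ℝ 2 (v t₀) := (hsm.contDiff_slice (mem_Iio.2 ht₀)).of_le (by norm_cast)
  have hdiv : VectorCalculus.IsDivFree (v t₀) := (hd t₀ ht₀).isDivFree_of_contDiff (h2.of_le (by norm_num))
  have hslice : ∀ x, v t₀ (x + h) = v t₀ x :=
    PoloidalWindowDoorPoloidalWindowRigidityVorticityTranslate.periodic_of_curl_periodic h2 hdiv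
      (fun z => hKb t₀ ht₀ z) hglob
  -- one periodic slice ⟹ all slices periodic
  exact classP_spacePeriodic_of_locallyPeriodic hc ⟨K, hKb⟩ hm h ht₀ isOpen_univ univ_nonempty fun x _ => hslice x

/-! ## §3 ★ Two sectors of (L) read off the vorticity of one slice -/

/-- ★ **THE VORTICITY OF ONE SLICE LOCALLY INVARIANT ALONG A LINE ⟹ ONE CONSTANT VECTOR.**  If for one `t₀ < 0`, one
unit vector `e`, some `δ > 0` and ONE nonempty open set `U`, `curl v(t₀)(x + s•e) = curl v(t₀)(x)` for all `x ∈ U` and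
`|s| < δ`, then the class-P flow is one constant vector (§2 for every small `s`, then the 2½-D wall
`classP_const_of_locallyTranslationInvariant`, KNSS Thm 5.1). [cite: KochNadirashviliSereginSverak2009, Thm. 5.1 (arXiv p. 9), p. 13; LemarieRieusset2016, Thm. 9.12] -/
theorem classP_const_of_curl_locallyLineInvariant
    {v : ℝ → EuclideanSpace ℝ (Fin 3) → EuclideanSpace ℝ (Fin 3)}
    (hc : ContinuousOn (uncurry v) (Iio 0 ×ˢ univ))
    (hK : ∃ K : ℝ, ∀ t < 0, ∀ x, ‖v t x‖ ≤ K)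
    (hd : ∀ t < 0, IsWeaklyDivFree (v t))
    (hm : ∀ s t : ℝ, s < t → t < 0 → ∀ x,
      v t x = heatExtension (v s) (t - s) x - oseenDuhamel 1 s v v t x)
    {e : EuclideanSpace ℝ (Fin 3)} (he : ‖e‖ = 1) {t₀ δ : ℝ} (ht₀ : t₀ < 0) (hδ : 0 < δ)
    {U : Set (EuclideanSpace ℝ (Fin 3))} (hUo : IsOpen U) (hUne : U.Nonempty)
    (h : ∀ s ∈ Ioo (-δ) δ, ∀ x ∈ U, curl (v t₀) (x + s • e) = curl (v t₀) x) :
    ∃ b : EuclideanSpace ℝ (Fin 3), ∀ t < 0, ∀ x, v t x = b :=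
  classP_const_of_locallyTranslationInvariant hc hK hd hm he ht₀ hδ hUo hUne fun s hs x _ =>
    classP_translationInvariant_of_curl_locally hc hK hd hm (s • e) ht₀ hUo hUne (h s hs) t₀ ht₀ x

/-- ★ **THE VORTICITY OF ONE SLICE `ℤ³`-PERIODIC ⟹ ONE CONSTANT VECTOR.**  If `curl v(t₀)` is lattice periodic for one
`t₀ < 0`, every slice of the class-P flow is lattice periodic (§2 with the three unit periods), and a spatially periodic
member of class P is one constant vector (`classP_const_of_isLatticePeriodic`).
[cite: KochNadirashviliSereginSverak2009, Remark 6.1 (arXiv:0709.3599); LemarieRieusset2016, Thm. 9.12] -/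
theorem classP_const_of_curl_latticePeriodic_slice
    {v : ℝ → EuclideanSpace ℝ (Fin 3) → EuclideanSpace ℝ (Fin 3)}
    (hc : ContinuousOn (uncurry v) (Iio 0 ×ˢ univ))
    (hK : ∃ K : ℝ, ∀ t < 0, ∀ x, ‖v t x‖ ≤ K)
    (hd : ∀ t < 0, IsWeaklyDivFree (v t))
    (hm : ∀ s t : ℝ, s < t → t < 0 → ∀ x,
      v t x = heatExtension (v s) (t - s) x - oseenDuhamel 1 s v v t x)
    {t₀ : ℝ} (ht₀ : t₀ < 0) (hper : Torus.IsLatticePeriodic (curl (v t₀))) :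
    ∃ b : EuclideanSpace ℝ (Fin 3), ∀ t < 0, ∀ x, v t x = b :=
  classP_const_of_isLatticePeriodic hc hK hd hm fun t ht j x =>
    classP_translationInvariant_of_curl_locally hc hK hd hm (EuclideanSpace.single j 1) ht₀ isOpen_univ
      univ_nonempty (fun y _ => hper j y) t ht x

/-- **… and locally: the vorticity of one slice `ℤ³`-periodic ON ONE PATCH ⟹ one constant vector** (each unit period is
read off the patch, §2). [cite: KochNadirashviliSereginSverak2009, Remark 6.1 (arXiv:0709.3599); LemarieRieusset2016, Thm. 9.12] -/
theorem classP_const_of_curl_locallyLatticePeriodic_slice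
    {v : ℝ → EuclideanSpace ℝ (Fin 3) → EuclideanSpace ℝ (Fin 3)}
    (hc : ContinuousOn (uncurry v) (Iio 0 ×ˢ univ))
    (hK : ∃ K : ℝ, ∀ t < 0, ∀ x, ‖v t x‖ ≤ K)
    (hd : ∀ t < 0, IsWeaklyDivFree (v t))
    (hm : ∀ s t : ℝ, s < t → t < 0 → ∀ x,
      v t x = heatExtension (v s) (t - s) x - oseenDuhamel 1 s v v t x)
    {t₀ : ℝ} (ht₀ : t₀ < 0) {U : Set (EuclideanSpace ℝ (Fin 3))} (hUo : IsOpen U) (hUne : U.Nonempty)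
    (hper : ∀ j : Fin 3, ∀ x ∈ U, curl (v t₀) (x + EuclideanSpace.single j 1) = curl (v t₀) x) :
    ∃ b : EuclideanSpace ℝ (Fin 3), ∀ t < 0, ∀ x, v t x = b :=
  classP_const_of_isLatticePeriodic hc hK hd hm fun t ht j x =>
    classP_translationInvariant_of_curl_locally hc hK hd hm (EuclideanSpace.single j 1) ht₀ hUo hUne (hper j) t ht x

/-! ## §4 ★ Harmonic vorticity on one patch of one slice -/

/-- ★ **THE VORTICITY OF ONE SLICE HARMONIC ON ONE PATCH ⟹ ONE CONSTANT VECTOR.**  If `Δ(curl v(t₀)) = 0` on ONE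
nonempty open set for one `t₀ < 0`, then: `Δ(curl v(t₀)) = −curl curl curl v(t₀)` is real-analytic on `ℝ³`, so it
vanishes identically; every coordinate of the bounded vorticity `curl v(t₀)` is a bounded harmonic function, hence
constant (Liouville); a slice with constant curl is invariant under every translation (`periodic_of_curl_periodic`),
i.e. constant; one constant slice forces a constant flow (`classP_const_of_locallyConst_slice`).
[cite: LemarieRieusset2016, Thm. 9.12; KochNadirashviliSereginSverak2009, Lemma 3.1, Remark 6.1 (arXiv:0709.3599)] -/
theorem classP_const_of_curl_locallyHarmonic_slice
    {v : ℝ → EuclideanSpace ℝ (Fin 3) → EuclideanSpace ℝ (Fin 3)}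
    (hc : ContinuousOn (uncurry v) (Iio 0 ×ˢ univ))
    (hK : ∃ K : ℝ, ∀ t < 0, ∀ x, ‖v t x‖ ≤ K)
    (hd : ∀ t < 0, IsWeaklyDivFree (v t))
    (hm : ∀ s t : ℝ, s < t → t < 0 → ∀ x,
      v t x = heatExtension (v s) (t - s) x - oseenDuhamel 1 s v v t x)
    {t₀ : ℝ} (ht₀ : t₀ < 0) {U : Set (EuclideanSpace ℝ (Fin 3))} (hUo : IsOpen U) (hUne : U.Nonempty)
    (h : ∀ x ∈ U, (Δ (curl (v t₀))) x = 0) :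
    ∃ b : EuclideanSpace ℝ (Fin 3), ∀ t < 0, ∀ x, v t x = b := by
  obtain ⟨K, hKb⟩ := hK
  obtain ⟨hsm', hbounds⟩ := smooth_and_bounds_of_bounded_ancient_oseenMild hc hd hm hKb
  have hsm : IsSmoothSpaceTimeOn (Iio 0) v := hsm'
  have hslice : ContDiff ℝ ∞ (v t₀) := hsm.contDiff_slice (mem_Iio.2 ht₀)
  have h2 : ContDiff ℝ 2 (v t₀) := hslice.of_le (by norm_cast)
  have h3 : ContDiff ℝ 3 (v t₀) := hslice.of_le (by norm_cast)
  have hω2 : ContDiff ℝ 2 (curl (v t₀)) := contDiff_curl (n := 2) (by exact_mod_cast h3)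
  have hdiv : VectorCalculus.IsDivFree (v t₀) := (hd t₀ ht₀).isDivFree_of_contDiff (h2.of_le (by norm_num))
  have hdivω : VectorCalculus.IsDivFree (curl (v t₀)) := fun x => divergence_curl_eq_zero_holds (v t₀) h2 x
  -- `Δω = − curl curl ω` is analytic, hence vanishes identically
  have hcurl_an : AnalyticOnNhd ℝ (curl (v t₀)) univ := classP_curl_analyticOnNhd_slice hc ⟨K, hKb⟩ hm ht₀
  have hcc_an : AnalyticOnNhd ℝ (curl (curl (v t₀))) univ := curlCLM.comp_analyticOnNhd hcurl_an.fderiv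
  have hccc_an : AnalyticOnNhd ℝ (curl (curl (curl (v t₀)))) univ := curlCLM.comp_analyticOnNhd hcc_an.fderiv
  have hΔfun : (Δ (curl (v t₀))) = fun x => -curl (curl (curl (v t₀))) x :=
    funext fun x => laplacian_eq_neg_curl_curl hω2 hdivω x
  have hΔan : AnalyticOnNhd ℝ (Δ (curl (v t₀))) univ := by
    rw [hΔfun]; exact fun x hx => (hccc_an x hx).neg
  have hΔ0 : ∀ x, (Δ (curl (v t₀))) x = 0 := const_of_analyticOnNhd_of_locallyConst hΔan hUo hUne (b := 0) h
  -- bounded harmonic coordinates ⟹ constant vorticity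
  obtain ⟨C₁, hC₁⟩ := hbounds 1
  have hωbd : ∀ y, ‖curl (v t₀) y‖ ≤ ‖curlCLM‖ * C₁ := by
    intro y
    have h1 : ‖fderiv ℝ (v t₀) y‖ ≤ C₁ := by
      have := hC₁ t₀ ht₀ y; rwa [norm_iteratedFDeriv_one] at this
    calc ‖curl (v t₀) y‖ = ‖curlCLM (fderiv ℝ (v t₀) y)‖ := rfl
      _ ≤ ‖curlCLM‖ * ‖fderiv ℝ (v t₀) y‖ := ContinuousLinearMap.le_opNorm _ _
      _ ≤ ‖curlCLM‖ * C₁ := mul_le_mul_of_nonneg_left h1 (norm_nonneg curlCLM)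
  have hωconst : ∀ x, curl (v t₀) x = curl (v t₀) 0 := by
    intro x
    ext i
    set η : EuclideanSpace ℝ (Fin 3) → ℝ := fun z => curl (v t₀) z i with hη
    have hηeq : η = (EuclideanSpace.proj i : EuclideanSpace ℝ (Fin 3) →L[ℝ] ℝ) ∘ curl (v t₀) := by
      funext z; rfl
    have hη2 : ContDiff ℝ 2 η := by
      rw [hηeq]; exact (EuclideanSpace.proj i : EuclideanSpace ℝ (Fin 3) →L[ℝ] ℝ).contDiff.comp hω2
    have hηΔ : ∀ z, (Δ η) z = 0 := fun z => by
      rw [hηeq, hω2.contDiffAt.laplacian_CLM_comp_left, Function.comp_apply, hΔ0 z, map_zero]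
    have hharm : InnerProductSpace.HarmonicOnNhd η univ := harmonicOnNhd_of_laplacian_eq_zero hη2 hηΔ
    have hbdd : ∀ z, |η z| ≤ ‖curlCLM‖ * C₁ := fun z =>
      le_trans (by simpa [hη, Real.norm_eq_abs] using PiLp.norm_apply_le (curl (v t₀) z) i) (hωbd z)
    exact hharm.apply_eq_apply_of_abs_le hbdd x 0
  -- constant curl ⟹ every translation is a symmetry of the slice ⟹ the slice is constant
  have hvconst : ∀ x, v t₀ x = v t₀ 0 := by
    intro x
    have hp : ∀ y, curl (v t₀) (y + x) = curl (v t₀) y := fun y => by rw [hωconst (y + x), hωconst y]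
    have := PoloidalWindowDoorPoloidalWindowRigidityVorticityTranslate.periodic_of_curl_periodic h2 hdiv
      (fun z => hKb t₀ ht₀ z) hp 0
    rwa [zero_add] at this
  exact ⟨v t₀ 0, classP_const_of_locallyConst_slice hc ⟨K, hKb⟩ hm ht₀ isOpen_univ univ_nonempty
    fun x _ => hvconst x⟩

/-- Contrapositive: **the vorticity of a NON-CONSTANT class-P flow is moved by small translations along EVERY line, on
EVERY patch of EVERY slice** — for every unit `e`, `δ > 0`, `t₀ < 0` and nonempty open `U` there are `|s| < δ` and
`x ∈ U` with `curl v(t₀)(x + s•e) ≠ curl v(t₀)(x)`. [cite: LemarieRieusset2016, Thm. 9.12; KochNadirashviliSereginSverak2009, Thm. 5.1] -/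
theorem classP_curl_moves_along_every_line_of_nonconst
    {v : ℝ → EuclideanSpace ℝ (Fin 3) → EuclideanSpace ℝ (Fin 3)}
    (hc : ContinuousOn (uncurry v) (Iio 0 ×ˢ univ))
    (hK : ∃ K : ℝ, ∀ t < 0, ∀ x, ‖v t x‖ ≤ K)
    (hd : ∀ t < 0, IsWeaklyDivFree (v t))
    (hm : ∀ s t : ℝ, s < t → t < 0 → ∀ x,
      v t x = heatExtension (v s) (t - s) x - oseenDuhamel 1 s v v t x)
    (hnc : ¬ ∃ b : EuclideanSpace ℝ (Fin 3), ∀ t < 0, ∀ x, v t x = b)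
    {e : EuclideanSpace ℝ (Fin 3)} (he : ‖e‖ = 1) {t₀ δ : ℝ} (ht₀ : t₀ < 0) (hδ : 0 < δ)
    {U : Set (EuclideanSpace ℝ (Fin 3))} (hUo : IsOpen U) (hUne : U.Nonempty) :
    ∃ s ∈ Ioo (-δ) δ, ∃ x ∈ U, curl (v t₀) (x + s • e) ≠ curl (v t₀) x := by
  by_contra hcon
  push Not at hcon
  exact hnc (classP_const_of_curl_locallyLineInvariant hc hK hd hm he ht₀ hδ hUo hUne hcon)

end Summit.NavierStokesRegularity.NavierStokesRegularity.Theorems.TypeILiouvilleVorticitySymmetry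

end
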